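import Literature.NumberTheory.EllipticCurves.BSDAverageRankFiveSelmer
import Literature.NumberTheory.EllipticCurves.HeightDensityLemmas
import Mathlib.Data.Nat.Prime.Infinite
import HarnessLib

/-!
# Rank `≤ 1` from a `p`-Selmer average at a general prime, and `100%` from all primes
# (Bhargava–Skinner–Zhang, Thm 25 (first part) and the Selmer-rank core of Thm 27)

Topic `Literature/NumberTheory/EllipticCurves`, family `bsd`. Companion of
`BSDRankLeOneDensityFiveSelmer.lean` (the case `p = 5` with the root-number family: Bhargava–Shankar's
`83.75%`), recording the same first-moment argument at a general prime `p`: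

> M. Bhargava, C. Skinner, W. Zhang, *A majority of elliptic curves over `ℚ` satisfy the Birch and
> Swinnerton-Dyer conjecture*, arXiv:1407.1826 (2014).
> **Thm 25** (first part, any large family `F` with average `#S_p = p + 1`): "`x + p²(1 - x) ≤ p + 1`,
> and hence `x ≥ (p² - p - 1)/(p² - 1)`", `x` the lower density of curves in `F` with `p`-Selmer rank
> `0` or `1`.
> **Thm 27**: "Consider the family of all elliptic curves over `ℚ` ordered by height. Suppose that for
> all primes `p`, the average size of the `p`-Selmer group of elliptic curves over `ℚ` is `p+1`. Then
> the Birch and Swinnerton-Dyer rank conjecture is true for `100%` of elliptic curves over `ℚ`."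
> (Proof, display: "a proportion of at least `(p²-p-1)/(p²-1)` have algebraic and analytic rank `0`
> or `1`. As `p` tends to infinity, [this] tends to `1`.")

What is proved here is the **rank** half of these statements (no `p`-converse theorem enters):
* `sq_sub_one_mul_ite_two_le_rank_le`: for every elliptic curve `E/ℚ` and prime `p`,
  **`(p² - 1)·[rank E(ℚ) ≥ 2] ≤ #Sel^(p)(E/ℚ) - 1`** (`rank ≥ 2 ⇒ p² ≤ p^rank ≤ #Sel^(p)`; the
  descent inequality `WeierstrassCurve.pow_rank_le_card_selmerGroup`, proved in the tree).
* `heightDensityGE_rankLeOne_of_heightAverageLE_card_selmer`: **if the average of `#Sel^(p)(E_{A,B}/ℚ)`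
  over the curves of naive height `< X` is eventually `≤ p + 1 + ε` for every `ε > 0`
  (`HeightAverageLE (#Sel^(p)) (p + 1)`, the `limsup` form of "the average size of the `p`-Selmer group
  is `p + 1`"), then at least a proportion `(p² - p - 1)/(p² - 1) = 1 - p/(p² - 1)` of elliptic curves
  over `ℚ`, ordered by naive height, have Mordell–Weil rank `≤ 1`** (`19/24` at `p = 5`, the tree's
  `heightDensityGE_rankLeOne_nineteen_24ths_of_heightAverageLE_card_selmerFive`; `41/48` at `p = 7`;
  `109/120` at `p = 11`).
* `heightDensityGE_rankLeOne_one_of_forall_prime`: **if this holds for every prime `p`, then `100%` of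
  elliptic curves over `ℚ` (lower density `1`) have rank `≤ 1`** — the Selmer-rank core of Thm 27
  (`p/(p² - 1) ≤ 1/(p - 1) → 0` along the primes, `Nat.exists_infinite_primes`). The source's Thm 27
  itself (algebraic AND analytic rank, i.e. the BSD rank conjecture for `100%`) needs in addition the
  `p`-converse criteria Thms 5 and 9 at every `p` on `S₀(p) ∩ S₁(p)`; that half is not recorded here.

## The root-number family at a general prime (Thm 25, second part, and Thm 21)

The source writes the parity-refined linear programmes at a general prime `p` as well, before
setting `p = 5`:
> **Thm 25** (second part, `F` with root numbers equidistributed): "`x₀ + p²(1/2 - x₀) +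
> p(x₁ + p²(1/2 - x₁)) ≤ p + 1`. Thus, we obtain `(p²-1)x₀ + (p³-p)x₁ ≥ (p³+p²)/2 - p - 1`. In
> conjunction with the constraint `x₁ ≤ 1/2`, it follows that
> `x_{0 or 1} ≥ x₀ + x₁ ≥ [(p²+p)/2 - p - 1]/(p²-1) + 1/2 = (2p-3)/(2p-2)`. Again, this bound is achieved
> when a proportion of `(p-2)/(2p-2)` … have `p`-Selmer rank `0`, a proportion of `1/2` … have
> `5`-Selmer rank `1`, and a proportion of `1/(2p-2)` … have `5`-Selmer rank `2`."
> **Thm 21** (proof): "among these `1/2` of curves in `F` with even `p`-Selmer rank, a lower density of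
> at least `(p-2)/(p-1)` have trivial `p`-Selmer group; i.e., a lower density of at least
> `1/2·(p-2)/(p-1) = (p-2)/(2p-2)` of curves in `F` have `p`-Selmer rank `0`."

The section `GeneralPrimeParity` records these, with the same bookkeeping as the case `p = 5` of
`BSDRankLeOneDensityFiveSelmer.lean` (the programmes are run pointwise on the integer
`m = s_p(E) - t_p(E) ≥ rank E(ℚ)`, `p^m ≤ #Sel^(p)`, `m` even iff `w(E) = +1` — the tree's
`exists_rank_le_of_parity`, i.e. Dokchitser–Dokchitser `hDD` — so no "`E(ℚ)[p] = 0` for `100%`" input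
is needed), and for a root-number family of lower density `κ` INSIDE the family of all curves
(interpolating the two parts of Thm 25 as Cor 26 does: `κ·(2p-3)/(2p-2) + (1-κ)·(p²-p-1)/(p²-1)`):
* `sq_sub_one_mul_ite_two_le_rank_le_of_parity`:
  **`(p² - 1)·[rank ≥ 2] ≤ #Sel^(p) - (p+1)/2 + ((p-1)/2)·w(E)`** (dual multipliers read off from the
  printed extremal configuration `((p-2)/(2p-2), 1/2, 1/(2p-2))`, where all cases are equalities);
  `le_sq_sub_one_mul_ite_rank_eq_zero_of_parity`:
  **`p(p+1)/2 - #Sel^(p) + (p(p-1)/2)·w(E) ≤ (p² - 1)·[rank = 0]`** (Thm 21 pointwise).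
* `card_two_le_rank_le_prime`, `le_card_rank_eq_zero_prime`: the counts at a finite height for a
  subfamily `U` stable under `E ↦ E₋₁ = E_{A,-B}` with `w(E₋₁) = -w(E)` (`∑_U w = 0`):
  `(p²-1)·#{rank ≥ 2} ≤ ∑_{all} #Sel^(p) - #{all} - ((p-1)/2)·#{U}` and
  `(p(p+1)/2)·#{U} - ∑_U #Sel^(p) ≤ (p²-1)·#{rank = 0}`.
* `heightDensityGE_rankLeOne_of_heightAverageLE_card_selmer_of_family`: **granted
  `HeightAverageLE (#Sel^(p)) (p + 1)` on the family of all curves, such a `U` of lower density `≥ κ`,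
  and `hDD`, at least a proportion `1 - p/(p²-1) + κ/(2(p+1))` of elliptic curves over `ℚ` have rank
  `≤ 1`** — `= κ·(2p-3)/(2p-2) + (1-κ)·(p²-p-1)/(p²-1)`; at `p = 5` this is `19/24 + κ/12`
  (`rankLeOne_density_prime_five`, the constant of `heightDensityGE_rankLeOne_of_five_selmer_family`);
  at `κ = 1` it is the printed `(2p-3)/(2p-2)` (`rankLeOne_density_kappa_one`): `1/2, 3/4, 7/8, 11/12,
  19/20` at `p = 2, 3, 5, 7, 11`.
* `heightDensityGE_rankZero_of_card_selmer_of_family`: **granted the `p`-Selmer average `≤ p + 1` ON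
  `U` (sum form), at least a proportion `κ·(p-2)/(2(p-1))` have rank `0`** (Thm 21; `3κ/8` at
  `p = 5`, `rankZero_density_prime_five`).
* `heightAverageLE_card_selmer_of_large_families`, `heightDensityGE_rankLeOne_of_selmer_family`,
  `heightDensityGE_rankZero_of_selmer_family`: the same with the inputs in the shape of the source's
  Thm 13 ("`p`-Selmer average `p + 1` in every large family", hypothesis `h13`, a theorem for
  `p ≤ 5` [BS2, BS3, BS5]) and of a finite disjoint union of large congruence families with
  equidistributed root number (the shape of Thm 16 / [BS5] Thm 6) — literally the binders of
  `heightDensityGE_rankLeOne_of_five_selmer_family` with `5 ↦ p`, `6 ↦ p + 1`.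

No new named fact (D-0026): the Selmer averages are hypotheses (for `p = 2, 3, 5` they are theorems of
Bhargava–Shankar; for `p ≥ 7` conjectural — Poonen–Rains; the source's §4: "if the Selmer average
results of [BS2], [BS3], and [BS5] could be extended to infinitely many primes, then the words
'A majority' … could be replaced with '`100%`'").

## References

* [BhargavaSkinnerZhang2014] M. Bhargava, C. Skinner, W. Zhang, arXiv:1407.1826: Thm 25 (first part,
  proof), Thm 27 and its proof, §1 p. 4 and §4.
* [BhargavaShankar5Selmer2013] M. Bhargava, A. Shankar, arXiv:1312.7859: Prop 38(b) (the case `p = 5`).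
* [SilvermanAEC2009] J. H. Silverman, *The Arithmetic of Elliptic Curves*, 2nd ed., Thm X.4.2.
* [BhargavaSkinnerZhang2014] (section `GeneralPrimeParity`) arXiv:1407.1826: Thm 13 (statement),
  Thm 21 (proof: "`(p-2)/(2p-2)`"), Thm 25 (second part, proof: "`(2p-3)/(2p-2)`"), Cor 26 (proof:
  "`(7/8)κ + (19/24)(1-κ)`").
* [DokchitserDokchitserAnnals2010] T. Dokchitser, V. Dokchitser, Ann. of Math. 172 (2010), Thm 1.4
  (the source's Thm 15; hypothesis `hDD`).
-/

noncomputable section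

open scoped Classical
open Filter Topology WeierstrassCurve

namespace Literature.NumberTheory.EllipticCurves

/-! ### Thm 25 (first part), pointwise and as a lower density -/

section GeneralPrime

/-- **Thm 25 (first part) pointwise**: for an elliptic curve `E/ℚ` and a prime `p`,
`(p² - 1)·[rank E(ℚ) ≥ 2] ≤ #Sel^(p)(E/ℚ) - 1` (if `rank ≥ 2` then `p² ≤ p^rank ≤ #Sel^(p)`; in any
case `1 ≤ #Sel^(p)`). [cite: BhargavaSkinnerZhang2014, Thm 25 (first part, proof: "x + p²(1 - x) ≤ p + 1")] -/
theorem sq_sub_one_mul_ite_two_le_rank_le (W : WeierstrassCurve ℚ) [W.IsElliptic] (p : ℕ)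
    [Fact p.Prime] :
    ((p : ℝ) ^ 2 - 1) * (if 2 ≤ W.mordellWeilRank then (1 : ℝ) else 0) ≤
      (Nat.card (W.selmerGroup p) : ℝ) - 1 := by
  have hp : p.Prime := Fact.out
  have hp1 : (1 : ℝ) ≤ p := by exact_mod_cast hp.one_lt.le
  have hpow := W.pow_rank_le_card_selmerGroup hp.ne_zero
  have hpowR : ((p : ℕ) ^ W.mordellWeilRank : ℝ) ≤ (Nat.card (W.selmerGroup p) : ℝ) := by
    exact_mod_cast hpow
  split_ifs with h2
  · have hsq : (p : ℝ) ^ 2 ≤ (p : ℝ) ^ W.mordellWeilRank := pow_le_pow_right₀ hp1 h2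
    linarith
  · have h1 : (1 : ℝ) ≤ (p : ℝ) ^ W.mordellWeilRank := one_le_pow₀ hp1
    linarith

/-- **Thm 25 (first part) for the family of all curves, granted the `p`-Selmer average alone.** If the
average of `#Sel^(p)(E_{A,B}/ℚ)` over the curves of naive height `< X` is eventually `≤ p + 1 + ε` for
every `ε > 0` (`HeightAverageLE`; for `p = 2, 3, 5` a theorem of Bhargava–Shankar, for `p ≥ 7` the
conjecture of Poonen–Rains / the source's §4), then at least a proportion
`(p² - p - 1)/(p² - 1) = 1 - p/(p² - 1)` of elliptic curves over `ℚ`, ordered by naive height, have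
Mordell–Weil rank `≤ 1` ("`x + p²(1 - x) ≤ p + 1`, and hence `x ≥ (p²-p-1)/(p²-1)`", with
`rank ≤` `p`-Selmer rank). No root numbers, parity theorem or large families enter.
[cite: BhargavaSkinnerZhang2014, Thm 25 (first part) and Thm 27 (proof, display "(p²-p-1)/(p²-1)")] -/
theorem heightDensityGE_rankLeOne_of_heightAverageLE_card_selmer (p : ℕ) [Fact p.Prime]
    (h1 : HeightAverageLE (fun AB ↦ (Nat.card ((shortWeierstrass AB).selmerGroup p) : ℝ)) (p + 1)) :
    HeightDensityGE (fun AB ↦ (shortWeierstrass AB).mordellWeilRank ≤ 1)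
      (((p : ℝ) ^ 2 - p - 1) / ((p : ℝ) ^ 2 - 1)) := by
  have hp : p.Prime := Fact.out
  have hp2 : (2 : ℝ) ≤ p := by exact_mod_cast hp.two_le
  have hden : (0 : ℝ) < (p : ℝ) ^ 2 - 1 := by nlinarith
  intro ε hε
  filter_upwards [h1 (((p : ℝ) ^ 2 - 1) * ε) (by positivity), eventually_ge_atTop 28]
    with X hX1 hX28
  have hell : ∀ AB ∈ heightFamilyBelow X, (shortWeierstrass AB).IsElliptic :=
    fun AB hAB ↦ isElliptic_shortWeierstrass ((mem_heightFamilyBelow_iff AB X).mp hAB).1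
  have hpos : 0 < (heightFamilyBelow X).card :=
    Finset.card_pos.mpr ⟨_, zeroOne_mem_heightFamilyBelow hX28⟩
  have hN : (0 : ℝ) < (heightFamilyBelow X).card := by exact_mod_cast hpos
  unfold heightAverage at hX1
  rw [div_le_iff₀ hN] at hX1
  rw [heightProportion_eq_card_div, le_div_iff₀ hN]
  -- the count: `(p² - 1)·#{rank ≥ 2} ≤ ∑ #Sel^(p) - #{all}`
  have hcount : ((p : ℝ) ^ 2 - 1) * (((heightFamilyBelow X).filter
        (fun AB ↦ 2 ≤ (shortWeierstrass AB).mordellWeilRank)).card : ℝ) ≤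
      ∑ AB ∈ heightFamilyBelow X, (Nat.card ((shortWeierstrass AB).selmerGroup p) : ℝ) -
        (heightFamilyBelow X).card := by
    rw [Finset.natCast_card_filter]
    have h := Finset.sum_le_sum (s := heightFamilyBelow X)
      (f := fun AB ↦ ((p : ℝ) ^ 2 - 1) *
        (if 2 ≤ (shortWeierstrass AB).mordellWeilRank then (1 : ℝ) else 0))
      (g := fun AB ↦ (Nat.card ((shortWeierstrass AB).selmerGroup p) : ℝ) - 1) fun AB hAB ↦ by
        haveI := hell AB hAB
        exact sq_sub_one_mul_ite_two_le_rank_le (shortWeierstrass AB) p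
    rw [← Finset.mul_sum, Finset.sum_sub_distrib, Finset.sum_const, nsmul_eq_mul] at h
    linarith
  have hcompl : (((heightFamilyBelow X).filter
        (fun AB ↦ (shortWeierstrass AB).mordellWeilRank ≤ 1)).card : ℝ) +
      ((heightFamilyBelow X).filter (fun AB ↦ 2 ≤ (shortWeierstrass AB).mordellWeilRank)).card =
      (heightFamilyBelow X).card := by
    have h := Finset.card_filter_add_card_filter_not (s := heightFamilyBelow X)
      (fun AB ↦ (shortWeierstrass AB).mordellWeilRank ≤ 1)
    have hcongr : (heightFamilyBelow X).filter
          (fun AB ↦ ¬ (shortWeierstrass AB).mordellWeilRank ≤ 1) =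
        (heightFamilyBelow X).filter (fun AB ↦ 2 ≤ (shortWeierstrass AB).mordellWeilRank) :=
      Finset.filter_congr fun AB _ ↦ ⟨fun h' ↦ by omega, fun h' ↦ by omega⟩
    rw [hcongr] at h
    exact_mod_cast h
  -- abbreviate and finish with real arithmetic
  set N : ℝ := ((heightFamilyBelow X).card : ℝ) with hNdef
  set R₂ : ℝ := (((heightFamilyBelow X).filter
    (fun AB ↦ 2 ≤ (shortWeierstrass AB).mordellWeilRank)).card : ℝ)
  set R₁ : ℝ := (((heightFamilyBelow X).filter
    (fun AB ↦ (shortWeierstrass AB).mordellWeilRank ≤ 1)).card : ℝ)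
  set S : ℝ := ∑ AB ∈ heightFamilyBelow X, (Nat.card ((shortWeierstrass AB).selmerGroup p) : ℝ)
  -- `(p²-1) R₂ ≤ S - N ≤ (p + (p²-1) ε) N`, so `R₁ = N - R₂ ≥ (1 - p/(p²-1) - ε) N`
  have hR₂ : ((p : ℝ) ^ 2 - 1) * R₂ ≤ ((p : ℝ) + ((p : ℝ) ^ 2 - 1) * ε) * N := by nlinarith
  have hR₂' : R₂ ≤ ((p : ℝ) / ((p : ℝ) ^ 2 - 1) + ε) * N := by
    rw [show ((p : ℝ) / ((p : ℝ) ^ 2 - 1) + ε) * N =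
      (((p : ℝ) + ((p : ℝ) ^ 2 - 1) * ε) * N) / ((p : ℝ) ^ 2 - 1) by field_simp]
    rw [le_div_iff₀ hden]
    linarith
  have hkey : (((p : ℝ) ^ 2 - p - 1) / ((p : ℝ) ^ 2 - 1)) = 1 - (p : ℝ) / ((p : ℝ) ^ 2 - 1) := by
    field_simp
    ring
  rw [hkey]
  nlinarith

/-- **The Selmer-rank core of Thm 27 of the source: `100%` from all primes.** If for every prime `p` the
average of `#Sel^(p)(E_{A,B}/ℚ)` over the curves of naive height `< X` is eventually `≤ p + 1 + ε` for
every `ε > 0`, then `100%` of elliptic curves over `ℚ`, ordered by naive height, have Mordell–Weil rank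
`≤ 1` (lower density `1`): by `heightDensityGE_rankLeOne_of_heightAverageLE_card_selmer` the lower density
is `≥ 1 - p/(p² - 1) ≥ 1 - 1/(p - 1)` for every prime `p`, and there are arbitrarily large primes. The
source's conclusion "the Birch and Swinnerton-Dyer rank conjecture is true for `100%`" needs, beyond
this, the criteria Thms 5 and 9 at every `p` (not recorded here).
[cite: BhargavaSkinnerZhang2014, Thm 27 (proof: "As p tends to infinity, the product … tends to 1")] -/
theorem heightDensityGE_rankLeOne_one_of_forall_prime
    (h : ∀ p : ℕ, p.Prime →
      HeightAverageLE (fun AB ↦ (Nat.card ((shortWeierstrass AB).selmerGroup p) : ℝ)) (p + 1)) :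
    HeightDensityGE (fun AB ↦ (shortWeierstrass AB).mordellWeilRank ≤ 1) 1 := by
  intro ε hε
  -- a prime `p` with `1/(p - 1) ≤ ε/2`, i.e. `p ≥ 2/ε + 1`
  obtain ⟨n, hn⟩ := exists_nat_gt (2 / ε + 1)
  obtain ⟨p, hnp, hp⟩ := Nat.exists_infinite_primes (n + 2)
  haveI : Fact p.Prime := ⟨hp⟩
  have hp2 : (2 : ℝ) ≤ p := by exact_mod_cast hp.two_le
  have hpn : (n : ℝ) + 2 ≤ p := by exact_mod_cast hnp
  have hden : (0 : ℝ) < (p : ℝ) ^ 2 - 1 := by nlinarith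
  have hp1 : (0 : ℝ) < (p : ℝ) - 1 := by linarith
  -- `p/(p²-1) ≤ ε/2`
  have hsmall : (p : ℝ) / ((p : ℝ) ^ 2 - 1) ≤ ε / 2 := by
    rw [div_le_iff₀ hden]
    have h2ε : 2 / ε < (p : ℝ) - 1 := by linarith
    have h2 : 2 < ((p : ℝ) - 1) * ε := by
      have := (div_lt_iff₀ hε).mp h2ε
      linarith
    nlinarith
  have hmain := heightDensityGE_rankLeOne_of_heightAverageLE_card_selmer p (h p hp) (ε / 2)
    (by positivity)
  filter_upwards [hmain] with X hX
  have hkey : (((p : ℝ) ^ 2 - p - 1) / ((p : ℝ) ^ 2 - 1)) = 1 - (p : ℝ) / ((p : ℝ) ^ 2 - 1) := by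
    field_simp
    ring
  rw [hkey] at hX
  linarith

end GeneralPrime

/-! ### Thm 25 (second part) and Thm 21 at a general prime, pointwise -/

section PerCurvePrime

variable (W : WeierstrassCurve ℚ) [W.IsElliptic] (p : ℕ) [Fact p.Prime]

/-- **Thm 25 (second part) pointwise** (with the source's Thm 15, Dokchitser–Dokchitser, hypothesis
`hDD`): for an elliptic curve `E/ℚ` and a prime `p`,
`(p² - 1)·[rank E(ℚ) ≥ 2] ≤ #Sel^(p)(E/ℚ) - (p+1)/2 + ((p-1)/2)·w(E)`, i.e. `≤ #Sel^(p) - 1` if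
`w(E) = +1` and `≤ #Sel^(p) - p` if `w(E) = -1`. With `m = s_p - t_p ≥ rank`, `p^m ≤ #Sel^(p)`, `m`
even iff `w = +1` (`exists_rank_le_of_parity`): for `w = +1` and `rank ≥ 2`, `m ≥ 2` and
`#Sel^(p) ≥ p²`; for `w = -1`, `m` is odd, so `#Sel^(p) ≥ p`, and `#Sel^(p) ≥ p³ ≥ p² + p - 1` if
`rank ≥ 2`. Summed over a family with `∑ w = 0` and average `#Sel^(p) ≤ p + 1` this is the printed
"`(p²-1)x₀ + (p³-p)x₁ ≥ (p³+p²)/2 - p - 1` … `x₀ + x₁ ≥ (2p-3)/(2p-2)`"; the multipliers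
`((p+1)/2, (p-1)/2, p²-1)` make the three printed extremal cases `((p-2)/(2p-2), 1/2, 1/(2p-2))` at
`p`-Selmer ranks `(0, 1, 2)` equalities. The case `p = 5` is
`twentyfour_mul_ite_two_le_rank_le_of_parity` (`BSDRankLeOneDensityFiveSelmer.lean`).
[cite: BhargavaSkinnerZhang2014, Thm 25 (second part, proof) and Thm 15] -/
theorem sq_sub_one_mul_ite_two_le_rank_le_of_parity (hDD : even_selmerRank_sub_torsionRank_iff) :
    ((p : ℝ) ^ 2 - 1) * (if 2 ≤ W.mordellWeilRank then (1 : ℝ) else 0) ≤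
      (Nat.card (W.selmerGroup p) : ℝ) - ((p : ℝ) + 1) / 2 +
        ((p : ℝ) - 1) / 2 * (W.rootNumber : ℝ) := by
  have hp : p.Prime := Fact.out
  have hp1 : (1 : ℝ) ≤ p := by exact_mod_cast hp.one_lt.le
  obtain ⟨m, hrm, hpow, hpar⟩ := exists_rank_le_of_parity W p hDD
  have hpowR : ((p ^ m : ℕ) : ℝ) ≤ (Nat.card (W.selmerGroup p) : ℝ) := by exact_mod_cast hpow
  push_cast at hpowR
  rcases W.rootNumber_eq_one_or with hw | hw
  · rw [hw]
    push_cast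
    split_ifs with h2
    · have hsq : (p : ℝ) ^ 2 ≤ (p : ℝ) ^ m := pow_le_pow_right₀ hp1 (h2.trans hrm)
      linarith
    · have h1 : (1 : ℝ) ≤ (p : ℝ) ^ m := one_le_pow₀ hp1
      linarith
  · have hodd : Odd m := by
      rcases Nat.even_or_odd m with h | h
      · exact absurd (hpar.mp h) (by rw [hw]; norm_num)
      · exact h
    rw [hw]
    push_cast
    split_ifs with h2
    · have hm3 : 3 ≤ m := by
        obtain ⟨k, hk⟩ := hodd
        omega
      have hcube : (p : ℝ) ^ 3 ≤ (p : ℝ) ^ m := pow_le_pow_right₀ hp1 hm3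
      -- `p² + p - 1 ≤ p³` for `p ≥ 1`: `p³ - p² - p + 1 = (p - 1)²(p + 1)`
      have hkey : (p : ℝ) ^ 2 + p - 1 ≤ (p : ℝ) ^ 3 := by
        nlinarith [mul_nonneg (mul_nonneg (sub_nonneg.2 hp1) (sub_nonneg.2 hp1))
          (by linarith : (0 : ℝ) ≤ (p : ℝ) + 1)]
      linarith
    · have hm1 : 1 ≤ m := by
        obtain ⟨k, hk⟩ := hodd
        omega
      have h1 : (p : ℝ) ^ 1 ≤ (p : ℝ) ^ m := pow_le_pow_right₀ hp1 hm1
      rw [pow_one] at h1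
      linarith

/-- **Thm 21 pointwise** (with Thm 15, `hDD`): for an elliptic curve `E/ℚ` and a prime `p`,
`p(p+1)/2 - #Sel^(p)(E/ℚ) + (p(p-1)/2)·w(E) ≤ (p² - 1)·[rank E(ℚ) = 0]`, i.e.
`p² - #Sel^(p) ≤ (p² - 1)·[rank = 0]` if `w(E) = +1` and `p - #Sel^(p) ≤ (p² - 1)·[rank = 0]` if
`w(E) = -1`. With `m = s_p - t_p` as above: if `w = +1` then `m` is even, and either `m = 0` (then
`rank = 0` and `#Sel^(p) ≥ 1`) or `m ≥ 2` (then `#Sel^(p) ≥ p²`); if `w = -1` then `m` is odd and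
`#Sel^(p) ≥ p` ("if the `p`-Selmer group of an elliptic curve has even rank, then it must have order
`1`, `p²`, or more than `p²` … `1/2` of the curves in `F` have odd `p`-Selmer rank and thus have at
least `p` elements in the `p`-Selmer group"). Summed over a family with `∑ w = 0` and average
`#Sel^(p) ≤ p + 1`: `x₀ ≥ (p-2)/(2p-2)`. The case `p = 5` is
`le_twentyfour_mul_ite_rank_eq_zero_of_parity` (`BSDRankLeOneDensityFiveSelmer.lean`).
[cite: BhargavaSkinnerZhang2014, Thm 21 (proof) and Thm 15] -/
theorem le_sq_sub_one_mul_ite_rank_eq_zero_of_parity (hDD : even_selmerRank_sub_torsionRank_iff) :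
    (p : ℝ) * ((p : ℝ) + 1) / 2 - (Nat.card (W.selmerGroup p) : ℝ) +
        (p : ℝ) * ((p : ℝ) - 1) / 2 * (W.rootNumber : ℝ) ≤
      ((p : ℝ) ^ 2 - 1) * (if W.mordellWeilRank = 0 then (1 : ℝ) else 0) := by
  have hp : p.Prime := Fact.out
  have hp1 : (1 : ℝ) ≤ p := by exact_mod_cast hp.one_lt.le
  obtain ⟨m, hrm, hpow, hpar⟩ := exists_rank_le_of_parity W p hDD
  have hpowR : ((p ^ m : ℕ) : ℝ) ≤ (Nat.card (W.selmerGroup p) : ℝ) := by exact_mod_cast hpow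
  push_cast at hpowR
  have hind : (0 : ℝ) ≤ (if W.mordellWeilRank = 0 then (1 : ℝ) else 0) := by
    split_ifs <;> norm_num
  have hD : (0 : ℝ) ≤ (p : ℝ) ^ 2 - 1 := by nlinarith
  have hDind := mul_nonneg hD hind
  rcases W.rootNumber_eq_one_or with hw | hw
  · rw [hw]
    push_cast
    rcases Nat.eq_zero_or_pos m with hm0 | hmpos
    · have hr : W.mordellWeilRank = 0 := by omega
      rw [if_pos hr] at hDind ⊢
      have h1 : (1 : ℝ) ≤ (p : ℝ) ^ m := one_le_pow₀ hp1
      nlinarith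
    · have hm2 : 2 ≤ m := by
        obtain ⟨k, hk⟩ := hpar.mpr hw
        omega
      have hsq : (p : ℝ) ^ 2 ≤ (p : ℝ) ^ m := pow_le_pow_right₀ hp1 hm2
      nlinarith
  · have hm1 : 1 ≤ m := by
      rcases Nat.even_or_odd m with h | h
      · exact absurd (hpar.mp h) (by rw [hw]; norm_num)
      · obtain ⟨k, hk⟩ := h
        omega
    rw [hw]
    push_cast
    have h1 : (p : ℝ) ^ 1 ≤ (p : ℝ) ^ m := pow_le_pow_right₀ hp1 hm1
    rw [pow_one] at h1
    nlinarith

end PerCurvePrime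

/-! ### The counts at a finite height and the lower densities, general prime -/

section ReductionPrime

variable (p : ℕ) [Fact p.Prime]

/-- **The count behind Thm 25 (both parts) at a finite height `X`, general prime.** Let `U` be
stable under `E ↦ E₋₁ = E_{A,-B}` with `w(E₋₁) = -w(E)` on `U` (so `∑_U w = 0`,
`sum_rootNumber_eq_zero`), and grant Thm 15 (`hDD`). Summing
`(p²-1)·[rank ≥ 2] ≤ #Sel^(p) - (p+1)/2 + ((p-1)/2)·w` (`sq_sub_one_mul_ite_two_le_rank_le_of_parity`)
over the members of `U` of height `< X` and `(p²-1)·[rank ≥ 2] ≤ #Sel^(p) - 1`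
(`sq_sub_one_mul_ite_two_le_rank_le`) over the other curves of height `< X` gives
`(p²-1)·#{H < X : rank ≥ 2} ≤ ∑_{H < X} #Sel^(p) - #{H < X} - ((p-1)/2)·#{U, H < X}`
(the second part of Thm 25 on `U`, the first part on its complement, before dividing by the number
of curves; `p = 5`: `card_two_le_rank_le` of `BSDRankLeOneDensityFiveSelmer.lean`).
[cite: BhargavaSkinnerZhang2014, Thm 25 (proof, both parts) and Cor 26 (proof)] -/
theorem card_two_le_rank_le_prime (hDD : even_selmerRank_sub_torsionRank_iff) (U : ℤ × ℤ → Prop)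
    (hU : ∀ AB, U AB → U (negB AB))
    (hflip : ∀ AB, U AB →
      (shortWeierstrass (negB AB)).rootNumber = -(shortWeierstrass AB).rootNumber) (X : ℕ) :
    ((p : ℝ) ^ 2 - 1) * (((heightFamilyBelow X).filter
        (fun AB ↦ 2 ≤ (shortWeierstrass AB).mordellWeilRank)).card : ℝ) ≤
      ∑ AB ∈ heightFamilyBelow X, (Nat.card ((shortWeierstrass AB).selmerGroup p) : ℝ) -
        (heightFamilyBelow X).card - ((p : ℝ) - 1) / 2 * ((heightFamilyBelow X).filter U).card := by
  -- members of the height family are elliptic curves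
  have hell : ∀ AB ∈ heightFamilyBelow X, (shortWeierstrass AB).IsElliptic :=
    fun AB hAB ↦ isElliptic_shortWeierstrass ((mem_heightFamilyBelow_iff AB X).mp hAB).1
  rw [Finset.natCast_card_filter]
  -- split the indicator sum, the Selmer sum and the count according to `U`
  have hsplitI := Finset.sum_filter_add_sum_filter_not (heightFamilyBelow X) U
    (fun AB ↦ (if 2 ≤ (shortWeierstrass AB).mordellWeilRank then (1 : ℝ) else 0))
  have hsplitS := Finset.sum_filter_add_sum_filter_not (heightFamilyBelow X) U
    (fun AB ↦ (Nat.card ((shortWeierstrass AB).selmerGroup p) : ℝ))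
  have hcards := Finset.card_filter_add_card_filter_not (s := heightFamilyBelow X) U
  have hcards' : (((heightFamilyBelow X).filter U).card : ℝ) +
      ((heightFamilyBelow X).filter (fun AB ↦ ¬ U AB)).card = (heightFamilyBelow X).card := by
    exact_mod_cast hcards
  -- on `U`: `(p²-1)·[rank ≥ 2] ≤ #Sel - (p+1)/2 + ((p-1)/2) w`, and `∑ w = 0`
  have hUsum : ((p : ℝ) ^ 2 - 1) * ∑ AB ∈ (heightFamilyBelow X).filter U,
      (if 2 ≤ (shortWeierstrass AB).mordellWeilRank then (1 : ℝ) else 0) ≤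
      ∑ AB ∈ (heightFamilyBelow X).filter U,
          (Nat.card ((shortWeierstrass AB).selmerGroup p) : ℝ) -
        ((p : ℝ) + 1) / 2 * ((heightFamilyBelow X).filter U).card := by
    have h := Finset.sum_le_sum (s := (heightFamilyBelow X).filter U)
      (f := fun AB ↦ ((p : ℝ) ^ 2 - 1) *
        (if 2 ≤ (shortWeierstrass AB).mordellWeilRank then (1 : ℝ) else 0))
      (g := fun AB ↦ (Nat.card ((shortWeierstrass AB).selmerGroup p) : ℝ) - ((p : ℝ) + 1) / 2 +
        ((p : ℝ) - 1) / 2 * ((shortWeierstrass AB).rootNumber : ℝ)) fun AB hAB ↦ by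
        haveI := hell AB (Finset.mem_filter.mp hAB).1
        exact sq_sub_one_mul_ite_two_le_rank_le_of_parity (shortWeierstrass AB) p hDD
    rw [← Finset.mul_sum, Finset.sum_add_distrib, Finset.sum_sub_distrib, ← Finset.mul_sum,
      sum_rootNumber_eq_zero U hU hflip X, Finset.sum_const, nsmul_eq_mul] at h
    linarith
  -- off `U`: `(p²-1)·[rank ≥ 2] ≤ #Sel - 1`
  have hCsum : ((p : ℝ) ^ 2 - 1) * ∑ AB ∈ (heightFamilyBelow X).filter (fun AB ↦ ¬ U AB),
      (if 2 ≤ (shortWeierstrass AB).mordellWeilRank then (1 : ℝ) else 0) ≤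
      ∑ AB ∈ (heightFamilyBelow X).filter (fun AB ↦ ¬ U AB),
          (Nat.card ((shortWeierstrass AB).selmerGroup p) : ℝ) -
        ((heightFamilyBelow X).filter (fun AB ↦ ¬ U AB)).card := by
    have h := Finset.sum_le_sum (s := (heightFamilyBelow X).filter (fun AB ↦ ¬ U AB))
      (f := fun AB ↦ ((p : ℝ) ^ 2 - 1) *
        (if 2 ≤ (shortWeierstrass AB).mordellWeilRank then (1 : ℝ) else 0))
      (g := fun AB ↦ (Nat.card ((shortWeierstrass AB).selmerGroup p) : ℝ) - 1) fun AB hAB ↦ by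
        haveI := hell AB (Finset.mem_filter.mp hAB).1
        exact sq_sub_one_mul_ite_two_le_rank_le (shortWeierstrass AB) p
    rw [← Finset.mul_sum, Finset.sum_sub_distrib, Finset.sum_const, nsmul_eq_mul] at h
    linarith
  rw [← hsplitI, ← hsplitS, ← hcards', mul_add]
  linarith [hUsum, hCsum]

/-- **The count behind Thm 21 at a finite height `X`, general prime.** For `U` stable under
`E ↦ E₋₁` with `w(E₋₁) = -w(E)` on `U`, granted Thm 15 (`hDD`): summing
`p(p+1)/2 - #Sel^(p) + (p(p-1)/2)·w ≤ (p²-1)·[rank = 0]`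
(`le_sq_sub_one_mul_ite_rank_eq_zero_of_parity`) over the members of `U` of height `< X`
(`∑_U w = 0`) gives `(p(p+1)/2)·#{U, H < X} - ∑_{U, H < X} #Sel^(p) ≤ (p²-1)·#{U, H < X : rank = 0}
≤ (p²-1)·#{H < X : rank = 0}` (`p = 5`: `le_card_rank_eq_zero` of `BSDRankLeOneDensityFiveSelmer.lean`).
[cite: BhargavaSkinnerZhang2014, Thm 21 (proof)] -/
theorem le_card_rank_eq_zero_prime (hDD : even_selmerRank_sub_torsionRank_iff) (U : ℤ × ℤ → Prop)
    (hU : ∀ AB, U AB → U (negB AB))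
    (hflip : ∀ AB, U AB →
      (shortWeierstrass (negB AB)).rootNumber = -(shortWeierstrass AB).rootNumber) (X : ℕ) :
    (p : ℝ) * ((p : ℝ) + 1) / 2 * (((heightFamilyBelow X).filter U).card : ℝ) -
        ∑ AB ∈ (heightFamilyBelow X).filter U,
          (Nat.card ((shortWeierstrass AB).selmerGroup p) : ℝ) ≤
      ((p : ℝ) ^ 2 - 1) * (((heightFamilyBelow X).filter
        (fun AB ↦ (shortWeierstrass AB).mordellWeilRank = 0)).card : ℝ) := by
  have hell : ∀ AB ∈ heightFamilyBelow X, (shortWeierstrass AB).IsElliptic :=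
    fun AB hAB ↦ isElliptic_shortWeierstrass ((mem_heightFamilyBelow_iff AB X).mp hAB).1
  rw [Finset.natCast_card_filter (fun AB ↦ (shortWeierstrass AB).mordellWeilRank = 0)]
  -- on `U`: `p(p+1)/2 - #Sel + (p(p-1)/2) w ≤ (p²-1)·[rank = 0]`, and `∑ w = 0`
  have hUsum : ∑ AB ∈ (heightFamilyBelow X).filter U,
      ((p : ℝ) * ((p : ℝ) + 1) / 2 - (Nat.card ((shortWeierstrass AB).selmerGroup p) : ℝ) +
        (p : ℝ) * ((p : ℝ) - 1) / 2 * ((shortWeierstrass AB).rootNumber : ℝ)) ≤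
      ((p : ℝ) ^ 2 - 1) * ∑ AB ∈ (heightFamilyBelow X).filter U,
        (if (shortWeierstrass AB).mordellWeilRank = 0 then (1 : ℝ) else 0) := by
    have h := Finset.sum_le_sum (s := (heightFamilyBelow X).filter U)
      (f := fun AB ↦ (p : ℝ) * ((p : ℝ) + 1) / 2 -
        (Nat.card ((shortWeierstrass AB).selmerGroup p) : ℝ) +
        (p : ℝ) * ((p : ℝ) - 1) / 2 * ((shortWeierstrass AB).rootNumber : ℝ))
      (g := fun AB ↦ ((p : ℝ) ^ 2 - 1) *
        (if (shortWeierstrass AB).mordellWeilRank = 0 then (1 : ℝ) else 0))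
      fun AB hAB ↦ by
        haveI := hell AB (Finset.mem_filter.mp hAB).1
        exact le_sq_sub_one_mul_ite_rank_eq_zero_of_parity (shortWeierstrass AB) p hDD
    rwa [← Finset.mul_sum] at h
  have hLHS : ∑ AB ∈ (heightFamilyBelow X).filter U,
      ((p : ℝ) * ((p : ℝ) + 1) / 2 - (Nat.card ((shortWeierstrass AB).selmerGroup p) : ℝ) +
        (p : ℝ) * ((p : ℝ) - 1) / 2 * ((shortWeierstrass AB).rootNumber : ℝ)) =
      (p : ℝ) * ((p : ℝ) + 1) / 2 * (((heightFamilyBelow X).filter U).card : ℝ) -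
        ∑ AB ∈ (heightFamilyBelow X).filter U,
          (Nat.card ((shortWeierstrass AB).selmerGroup p) : ℝ) := by
    rw [Finset.sum_add_distrib, Finset.sum_sub_distrib, ← Finset.mul_sum,
      sum_rootNumber_eq_zero U hU hflip X, Finset.sum_const, nsmul_eq_mul]
    ring
  -- the members of `U` of rank `0` are among all curves of rank `0`
  have hmono : ∑ AB ∈ (heightFamilyBelow X).filter U,
      (if (shortWeierstrass AB).mordellWeilRank = 0 then (1 : ℝ) else 0) ≤
      ∑ AB ∈ heightFamilyBelow X,
        (if (shortWeierstrass AB).mordellWeilRank = 0 then (1 : ℝ) else 0) :=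
    Finset.sum_le_sum_of_subset_of_nonneg (Finset.filter_subset _ _)
      fun _ _ _ ↦ by split_ifs <;> norm_num
  have hp : p.Prime := Fact.out
  have hp2 : (2 : ℝ) ≤ p := by exact_mod_cast hp.two_le
  have hD : (0 : ℝ) ≤ (p : ℝ) ^ 2 - 1 := by nlinarith
  have hmono' := mul_le_mul_of_nonneg_left hmono hD
  linarith

/-- **Thm 25 (both parts) for a root-number family of density `κ` inside the family of all curves,
general prime.** If the average of `#Sel^(p)(E_{A,B}/ℚ)` over the curves of naive height `< X` is
eventually `≤ p + 1 + ε` for every `ε > 0` (`HeightAverageLE (#Sel^(p)) (p + 1)`; the source's Thm 13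
for `p ≤ 5`, conjectural beyond), if there is a subfamily `U` of lower density `≥ κ`, stable under
`E ↦ E₋₁ = E_{A,-B}` with `w(E₋₁) = -w(E)` ("root numbers are equidistributed in `U`", the shape of
the source's Thm 16), and if (`hDD`, Thm 15) Dokchitser–Dokchitser parity holds, then at least a
proportion **`1 - p/(p²-1) + κ/(2(p+1)) = κ·(2p-3)/(2p-2) + (1-κ)·(p²-p-1)/(p²-1)`** of elliptic
curves over `ℚ`, ordered by naive height, have Mordell–Weil rank `≤ 1` (`liminf` form): the second
part of Thm 25 on `U` ("`x₀ + x₁ ≥ (2p-3)/(2p-2)`") and the first on its complement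
("`x ≥ (p²-p-1)/(p²-1)`"), combined as in the proof of Cor 26 ("`(7/8)κ + (19/24)(1-κ)`" at
`p = 5`), with `rank ≤ s_p - t_p`. Proof: `card_two_le_rank_le_prime` with
`∑ #Sel^(p) ≤ (p + 1 + η)·#{all}` and `#{U} ≥ (κ - η)·#{all}`. Values at `κ = 1`: `1/2, 3/4, 7/8,
11/12, 19/20, 23/24` for `p = 2, 3, 5, 7, 11, 13` (`rankLeOne_density_kappa_one`); at `p = 5`:
`19/24 + κ/12` (`rankLeOne_density_prime_five`).
[cite: BhargavaSkinnerZhang2014, Thm 25 (proof, both parts) and Cor 26 (proof)] -/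
theorem heightDensityGE_rankLeOne_of_heightAverageLE_card_selmer_of_family {κ : ℝ}
    (h1 : HeightAverageLE (fun AB ↦ (Nat.card ((shortWeierstrass AB).selmerGroup p) : ℝ)) (p + 1))
    (hU : ∃ U : ℤ × ℤ → Prop, (∀ AB, U AB → U (negB AB)) ∧
      (∀ AB, U AB → (shortWeierstrass (negB AB)).rootNumber = -(shortWeierstrass AB).rootNumber) ∧
      HeightDensityGE U κ)
    (hDD : even_selmerRank_sub_torsionRank_iff) :
    HeightDensityGE (fun AB ↦ (shortWeierstrass AB).mordellWeilRank ≤ 1)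
      (1 - (p : ℝ) / ((p : ℝ) ^ 2 - 1) + κ / (2 * ((p : ℝ) + 1))) := by
  obtain ⟨U, hUneg, hflip, hdens⟩ := hU
  have hp : p.Prime := Fact.out
  have hp2 : (2 : ℝ) ≤ p := by exact_mod_cast hp.two_le
  have hden : (0 : ℝ) < (p : ℝ) ^ 2 - 1 := by nlinarith
  intro ε hε
  filter_upwards [h1 ε hε, hdens ε hε, eventually_ge_atTop 28] with X hX1 hX3 hX28
  have hell : ∀ AB ∈ heightFamilyBelow X, (shortWeierstrass AB).IsElliptic :=
    fun AB hAB ↦ isElliptic_shortWeierstrass ((mem_heightFamilyBelow_iff AB X).mp hAB).1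
  have hpos : 0 < (heightFamilyBelow X).card :=
    Finset.card_pos.mpr ⟨_, zeroOne_mem_heightFamilyBelow hX28⟩
  have hN : (0 : ℝ) < (heightFamilyBelow X).card := by exact_mod_cast hpos
  unfold heightAverage at hX1
  rw [div_le_iff₀ hN] at hX1
  rw [heightProportion_eq_card_div, le_div_iff₀ hN] at hX3
  rw [heightProportion_eq_card_div, le_div_iff₀ hN]
  -- the count, and the complement `#{rank ≤ 1} + #{rank ≥ 2} = #{all}`
  have hcount := card_two_le_rank_le_prime p hDD U hUneg hflip X
  have hcompl : (((heightFamilyBelow X).filter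
        (fun AB ↦ (shortWeierstrass AB).mordellWeilRank ≤ 1)).card : ℝ) +
      ((heightFamilyBelow X).filter (fun AB ↦ 2 ≤ (shortWeierstrass AB).mordellWeilRank)).card =
      (heightFamilyBelow X).card := by
    have h := Finset.card_filter_add_card_filter_not (s := heightFamilyBelow X)
      (fun AB ↦ (shortWeierstrass AB).mordellWeilRank ≤ 1)
    have hcongr : (heightFamilyBelow X).filter
          (fun AB ↦ ¬ (shortWeierstrass AB).mordellWeilRank ≤ 1) =
        (heightFamilyBelow X).filter (fun AB ↦ 2 ≤ (shortWeierstrass AB).mordellWeilRank) :=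
      Finset.filter_congr fun AB _ ↦ ⟨fun h' ↦ by omega, fun h' ↦ by omega⟩
    rw [hcongr] at h
    exact_mod_cast h
  -- abbreviate and finish with real arithmetic
  set N : ℝ := ((heightFamilyBelow X).card : ℝ) with hNdef
  set NU : ℝ := (((heightFamilyBelow X).filter U).card : ℝ)
  set R₂ : ℝ := (((heightFamilyBelow X).filter
    (fun AB ↦ 2 ≤ (shortWeierstrass AB).mordellWeilRank)).card : ℝ)
  set R₁ : ℝ := (((heightFamilyBelow X).filter
    (fun AB ↦ (shortWeierstrass AB).mordellWeilRank ≤ 1)).card : ℝ)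
  set S : ℝ := ∑ AB ∈ heightFamilyBelow X, (Nat.card ((shortWeierstrass AB).selmerGroup p) : ℝ)
  -- `(p²-1) R₂ ≤ S - N - (p-1)/2·NU ≤ (p + ε) N - (p-1)/2·(κ - ε) N ≤ (p - (p-1)κ/2 + (p²-1) ε) N`
  have hNU := mul_le_mul_of_nonneg_left hX3 (by linarith : (0 : ℝ) ≤ ((p : ℝ) - 1) / 2)
  have hslack : ε * N + ((p : ℝ) - 1) / 2 * (ε * N) ≤ ((p : ℝ) ^ 2 - 1) * ε * N := by
    have hεN : 0 ≤ ε * N := by positivity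
    have hq : (0 : ℝ) ≤ (p : ℝ) ^ 2 - 1 - (1 + ((p : ℝ) - 1) / 2) := by nlinarith
    nlinarith [mul_nonneg hεN hq]
  have hR₂ : ((p : ℝ) ^ 2 - 1) * R₂ ≤
      (((p : ℝ) - ((p : ℝ) - 1) / 2 * κ) + ((p : ℝ) ^ 2 - 1) * ε) * N := by
    linarith [hcount, hX1, hNU, hslack]
  have hR₂' : R₂ ≤ (((p : ℝ) - ((p : ℝ) - 1) / 2 * κ) / ((p : ℝ) ^ 2 - 1) + ε) * N := by
    rw [show (((p : ℝ) - ((p : ℝ) - 1) / 2 * κ) / ((p : ℝ) ^ 2 - 1) + ε) * N =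
      ((((p : ℝ) - ((p : ℝ) - 1) / 2 * κ) + ((p : ℝ) ^ 2 - 1) * ε) * N) / ((p : ℝ) ^ 2 - 1) by
        field_simp]
    rw [le_div_iff₀ hden]
    linarith
  have hp1 : (p : ℝ) + 1 ≠ 0 := by positivity
  have hD : (p : ℝ) ^ 2 - 1 ≠ 0 := hden.ne'
  have hkey : 1 - (p : ℝ) / ((p : ℝ) ^ 2 - 1) + κ / (2 * ((p : ℝ) + 1)) =
      1 - ((p : ℝ) - ((p : ℝ) - 1) / 2 * κ) / ((p : ℝ) ^ 2 - 1) := by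
    field_simp
    ring
  rw [hkey]
  linarith [hcompl, hR₂']

/-- **Thm 21 for a root-number family of density `κ`, general prime.** If there is a subfamily `U`
of lower density `≥ κ`, stable under `E ↦ E₋₁ = E_{A,-B}` with `w(E₋₁) = -w(E)`, over which the
`p`-Selmer groups average eventually `≤ p + 1 + ε` for every `ε > 0` — in the cleared form
`∑_{U, H < X} #Sel^(p) ≤ (p + 1 + ε)·#{U, H < X}` (the source's Thm 13 on the large pieces of `U`,
`eventually_sum_le_of_heightAverageOn_le`) — and (`hDD`, Thm 15) Dokchitser–Dokchitser parity holds,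
then at least a proportion **`κ·(p-2)/(2(p-1))`** of elliptic curves over `ℚ`, ordered by naive
height, have Mordell–Weil rank `0` ("a lower density of at least `1/2·(p-2)/(p-1) = (p-2)/(2p-2)` of
curves in `F` have `p`-Selmer rank `0`", and `p`-Selmer rank `0` forces rank `0`). Proof:
`le_card_rank_eq_zero_prime` with `∑_U #Sel^(p) ≤ (p + 1 + η)·#{U}` and `(κ - η)·#{all} ≤ #{U} ≤ #{all}`.
At `p = 5`: `3κ/8` (`rankZero_density_prime_five`); at `p = 2` the bound is `0`, at `p = 3` it is `κ/4`.
[cite: BhargavaSkinnerZhang2014, Thm 21 (proof) and Cor 22 (proof: "`3/8·κ·μ(S₀(5))`")] -/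
theorem heightDensityGE_rankZero_of_card_selmer_of_family {κ : ℝ}
    (hU : ∃ U : ℤ × ℤ → Prop, (∀ AB, U AB → U (negB AB)) ∧
      (∀ AB, U AB → (shortWeierstrass (negB AB)).rootNumber = -(shortWeierstrass AB).rootNumber) ∧
      HeightDensityGE U κ ∧
      (∀ ε : ℝ, 0 < ε → ∀ᶠ X : ℕ in atTop,
        ∑ AB ∈ (heightFamilyBelow X).filter U,
            (Nat.card ((shortWeierstrass AB).selmerGroup p) : ℝ) ≤
          ((p : ℝ) + 1 + ε) * ((heightFamilyBelow X).filter U).card))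
    (hDD : even_selmerRank_sub_torsionRank_iff) :
    HeightDensityGE (fun AB ↦ (shortWeierstrass AB).mordellWeilRank = 0)
      (κ * ((p : ℝ) - 2) / (2 * ((p : ℝ) - 1))) := by
  obtain ⟨U, hUneg, hflip, hdens, hUsum⟩ := hU
  have hp : p.Prime := Fact.out
  have hp2 : (2 : ℝ) ≤ p := by exact_mod_cast hp.two_le
  have hden : (0 : ℝ) < (p : ℝ) ^ 2 - 1 := by nlinarith
  intro ε hε
  filter_upwards [hUsum ε hε, hdens ε hε, eventually_ge_atTop 28] with X hX1 hX3 hX28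
  have hpos : 0 < (heightFamilyBelow X).card :=
    Finset.card_pos.mpr ⟨_, zeroOne_mem_heightFamilyBelow hX28⟩
  have hN : (0 : ℝ) < (heightFamilyBelow X).card := by exact_mod_cast hpos
  rw [heightProportion_eq_card_div, le_div_iff₀ hN] at hX3
  rw [heightProportion_eq_card_div, le_div_iff₀ hN]
  have hcount := le_card_rank_eq_zero_prime p hDD U hUneg hflip X
  -- `#{U} ≤ #{all}`
  have hUle : (((heightFamilyBelow X).filter U).card : ℝ) ≤ (heightFamilyBelow X).card := by
    exact_mod_cast Finset.card_le_card (Finset.filter_subset _ _)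
  set N : ℝ := ((heightFamilyBelow X).card : ℝ) with hNdef
  set NU : ℝ := (((heightFamilyBelow X).filter U).card : ℝ)
  set R₀ : ℝ := (((heightFamilyBelow X).filter
    (fun AB ↦ (shortWeierstrass AB).mordellWeilRank = 0)).card : ℝ)
  set SU : ℝ := ∑ AB ∈ (heightFamilyBelow X).filter U,
    (Nat.card ((shortWeierstrass AB).selmerGroup p) : ℝ)
  -- `(p²-1) R₀ ≥ ((p+1)(p-2)/2) NU - ε NU ≥ ((p+1)(p-2)/2)(κ - ε) N - ε N`
  have hc : (0 : ℝ) ≤ ((p : ℝ) + 1) * ((p : ℝ) - 2) / 2 := by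
    have : (0 : ℝ) ≤ (p : ℝ) - 2 := by linarith
    positivity
  have hNU := mul_le_mul_of_nonneg_left hX3 hc
  have hεU : ε * NU ≤ ε * N := mul_le_mul_of_nonneg_left hUle hε.le
  -- slack: `ε·((p+1)(p-2)/2 + 1)·N ≤ (p²-1)·ε·N`, since `(p² - p)/2 ≤ p² - 1`
  have hslack : ((p : ℝ) + 1) * ((p : ℝ) - 2) / 2 * (ε * N) + ε * N ≤
      ((p : ℝ) ^ 2 - 1) * ε * N := by
    have hεN : 0 ≤ ε * N := by positivity
    have hq : (0 : ℝ) ≤ (p : ℝ) ^ 2 - 1 - (((p : ℝ) + 1) * ((p : ℝ) - 2) / 2 + 1) := by nlinarith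
    nlinarith [mul_nonneg hεN hq]
  have hR₀ : (((p : ℝ) + 1) * ((p : ℝ) - 2) / 2 * κ - ((p : ℝ) ^ 2 - 1) * ε) * N ≤
      ((p : ℝ) ^ 2 - 1) * R₀ := by
    linarith [hcount, hX1, hNU, hεU, hslack]
  have hR₀' : (((p : ℝ) + 1) * ((p : ℝ) - 2) / 2 * κ / ((p : ℝ) ^ 2 - 1) - ε) * N ≤ R₀ := by
    rw [show (((p : ℝ) + 1) * ((p : ℝ) - 2) / 2 * κ / ((p : ℝ) ^ 2 - 1) - ε) * N =
      ((((p : ℝ) + 1) * ((p : ℝ) - 2) / 2 * κ - ((p : ℝ) ^ 2 - 1) * ε) * N) / ((p : ℝ) ^ 2 - 1) by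
        field_simp]
    rw [div_le_iff₀ hden]
    linarith
  have hpm1 : (p : ℝ) - 1 ≠ 0 := by
    have : (0 : ℝ) < (p : ℝ) - 1 := by linarith
    exact this.ne'
  have hD : (p : ℝ) ^ 2 - 1 ≠ 0 := hden.ne'
  have hkey : κ * ((p : ℝ) - 2) / (2 * ((p : ℝ) - 1)) =
      ((p : ℝ) + 1) * ((p : ℝ) - 2) / 2 * κ / ((p : ℝ) ^ 2 - 1) := by
    field_simp
    ring
  rw [hkey]
  exact hR₀'

/-! #### Sanity checks on the constants -/

/-- At `p = 5` the constant of `heightDensityGE_rankLeOne_of_heightAverageLE_card_selmer_of_family` is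
Bhargava–Shankar's `7κ/8 + 19(1-κ)/24 = 19/24 + κ/12` (the constant of
`heightDensityGE_rankLeOne_of_five_selmer_family`; `83.75%` at `κ = .5501`).
[cite: BhargavaSkinnerZhang2014, Cor 26 (proof: "(7/8)κ + (19/24)(1-κ)")] -/
theorem rankLeOne_density_prime_five (κ : ℝ) :
    1 - (5 : ℝ) / ((5 : ℝ) ^ 2 - 1) + κ / (2 * ((5 : ℝ) + 1)) = 19 / 24 + κ / 12 := by
  norm_num

/-- At `κ = 1` (root numbers equidistributed in a subfamily of density `1`) the constant of
`heightDensityGE_rankLeOne_of_heightAverageLE_card_selmer_of_family` is the printed `(2p-3)/(2p-2)`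
(`p ≥ 2`; `1/2, 3/4, 7/8, 11/12, 19/20, 23/24` at `p = 2, 3, 5, 7, 11, 13`).
[cite: BhargavaSkinnerZhang2014, Thm 25 (second part, proof: "= (2p-3)/(2p-2)")] -/
theorem rankLeOne_density_kappa_one {q : ℝ} (hq : 2 ≤ q) :
    1 - q / (q ^ 2 - 1) + 1 / (2 * (q + 1)) = (2 * q - 3) / (2 * q - 2) := by
  have h1 : q + 1 ≠ 0 := by positivity
  have h2 : q - 1 ≠ 0 := by
    have : (0 : ℝ) < q - 1 := by linarith
    exact this.ne'
  have h3 : q ^ 2 - 1 ≠ 0 := by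
    have : (0 : ℝ) < q ^ 2 - 1 := by nlinarith
    exact this.ne'
  have h4 : 2 * q - 2 ≠ 0 := by
    have : (0 : ℝ) < 2 * q - 2 := by linarith
    exact this.ne'
  field_simp
  ring

/-- At `p = 5` the constant of `heightDensityGE_rankZero_of_card_selmer_of_family` is
Bhargava–Shankar's `3κ/8` (the constant of `heightDensityGE_rankZero_of_five_selmer_family`; `20.62%`
at `κ = .5501`). [cite: BhargavaSkinnerZhang2014, Thm 21 (proof: "For p = 5, this yields … 3/8")] -/
theorem rankZero_density_prime_five (κ : ℝ) :
    κ * ((5 : ℝ) - 2) / (2 * ((5 : ℝ) - 1)) = 3 * κ / 8 := by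
  ring

/-! #### The same statements with the inputs in the shape of the source's Thms 13 and 16 -/

omit [Fact p.Prime] in
/-- **Thm 13 on the family of all curves gives the height average.** If (`h13`, the source's Thm 13
at the prime `p`, in `limsup` form) over every large congruence family the average of
`#Sel^(p)(E_{A,B}/ℚ)` is eventually `≤ p + 1 + ε`, then in particular
`HeightAverageLE (#Sel^(p)) (p + 1)` — the family of all curves is large
(`CongruenceFamily.isLarge_allCurves`) and its members of height `< X` are all of `heightFamilyBelow X`.
[cite: BhargavaSkinnerZhang2014, Thm 13 (with §2: "all curves" is a large family)] -/
theorem heightAverageLE_card_selmer_of_large_families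
    (h13 : ∀ F : CongruenceFamily, F.IsLarge → ∀ ε : ℝ, 0 < ε → ∀ᶠ X : ℕ in atTop,
      heightAverageOn F.Mem (fun AB ↦ (Nat.card ((shortWeierstrass AB).selmerGroup p) : ℝ)) X ≤
        p + 1 + ε) :
    HeightAverageLE (fun AB ↦ (Nat.card ((shortWeierstrass AB).selmerGroup p) : ℝ)) (p + 1) := by
  intro ε hε
  filter_upwards [h13 _ CongruenceFamily.isLarge_allCurves ε hε] with X hX
  have hfilt : (heightFamilyBelow X).filter
      (CongruenceFamily.mk (fun _ ↦ 0) (fun _ ↦ Set.univ) True True).Mem = heightFamilyBelow X :=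
    Finset.filter_true_of_mem fun AB hAB ↦
      (CongruenceFamily.mem_allCurves_iff AB).mpr ((mem_heightFamilyBelow_iff AB X).mp hAB).1
  unfold heightAverageOn at hX
  rw [hfilt] at hX
  exact hX

/-- **Thm 25 (both parts) with the inputs of the source, general prime** — literally the binders of
`heightDensityGE_rankLeOne_of_five_selmer_family` with `5 ↦ p` and `6 ↦ p + 1`: if (`h13`) the
`p`-Selmer average over every large congruence family is eventually `≤ p + 1 + ε`, if (`hF`, the shape
of Thm 16 / [BS5] Thm 6) there is a finite disjoint union `U` of large congruence families of lower
density `≥ κ`, stable under `E ↦ E₋₁ = E_{A,-B}` with `w(E₋₁) = -w(E)`, and if (`hDD`, Thm 15)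
Dokchitser–Dokchitser parity holds, then at least a proportion `1 - p/(p²-1) + κ/(2(p+1))` of elliptic
curves over `ℚ`, ordered by naive height, have Mordell–Weil rank `≤ 1`. (Only `h13` on the family of
all curves is used, `heightAverageLE_card_selmer_of_large_families`.)
[cite: BhargavaSkinnerZhang2014, Thm 25 (proof, both parts), Cor 26 (proof), Thms 13, 15, 16] -/
theorem heightDensityGE_rankLeOne_of_selmer_family {κ : ℝ}
    (h13 : ∀ F : CongruenceFamily, F.IsLarge → ∀ ε : ℝ, 0 < ε → ∀ᶠ X : ℕ in atTop,
      heightAverageOn F.Mem (fun AB ↦ (Nat.card ((shortWeierstrass AB).selmerGroup p) : ℝ)) X ≤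
        p + 1 + ε)
    (hF : ∃ (n : ℕ) (F : Fin n → CongruenceFamily), (∀ i, (F i).IsLarge) ∧
      (∀ i j, i ≠ j → ∀ AB, (F i).Mem AB → ¬ (F j).Mem AB) ∧
      (∀ AB, UnionMem F AB → UnionMem F (AB.1, -AB.2)) ∧
      (∀ AB, UnionMem F AB →
        (shortWeierstrass (AB.1, -AB.2)).rootNumber = -(shortWeierstrass AB).rootNumber) ∧
      HeightDensityGE (UnionMem F) κ)
    (hDD : even_selmerRank_sub_torsionRank_iff) :
    HeightDensityGE (fun AB ↦ (shortWeierstrass AB).mordellWeilRank ≤ 1)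
      (1 - (p : ℝ) / ((p : ℝ) ^ 2 - 1) + κ / (2 * ((p : ℝ) + 1))) := by
  obtain ⟨n, F, -, -, htwist, hflip, hdens⟩ := hF
  exact heightDensityGE_rankLeOne_of_heightAverageLE_card_selmer_of_family p
    (heightAverageLE_card_selmer_of_large_families p h13)
    ⟨UnionMem F, fun AB h ↦ htwist AB h, fun AB h ↦ hflip AB h, hdens⟩ hDD

/-- **Thm 21 with the inputs of the source, general prime** (the binders of
`heightDensityGE_rankZero_of_five_selmer_family` with `5 ↦ p`, `6 ↦ p + 1`): under `h13`, `hF`, `hDD`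
as in `heightDensityGE_rankLeOne_of_selmer_family`, at least a proportion `κ·(p-2)/(2(p-1))` of elliptic
curves over `ℚ`, ordered by naive height, have Mordell–Weil rank `0` (`h13` on each large piece of `U`,
summed by `eventually_sum_le_of_heightAverageOn_le`).
[cite: BhargavaSkinnerZhang2014, Thm 21 (proof), Cor 22 (proof), Thms 13, 15, 16] -/
theorem heightDensityGE_rankZero_of_selmer_family {κ : ℝ}
    (h13 : ∀ F : CongruenceFamily, F.IsLarge → ∀ ε : ℝ, 0 < ε → ∀ᶠ X : ℕ in atTop,
      heightAverageOn F.Mem (fun AB ↦ (Nat.card ((shortWeierstrass AB).selmerGroup p) : ℝ)) X ≤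
        p + 1 + ε)
    (hF : ∃ (n : ℕ) (F : Fin n → CongruenceFamily), (∀ i, (F i).IsLarge) ∧
      (∀ i j, i ≠ j → ∀ AB, (F i).Mem AB → ¬ (F j).Mem AB) ∧
      (∀ AB, UnionMem F AB → UnionMem F (AB.1, -AB.2)) ∧
      (∀ AB, UnionMem F AB →
        (shortWeierstrass (AB.1, -AB.2)).rootNumber = -(shortWeierstrass AB).rootNumber) ∧
      HeightDensityGE (UnionMem F) κ)
    (hDD : even_selmerRank_sub_torsionRank_iff) :
    HeightDensityGE (fun AB ↦ (shortWeierstrass AB).mordellWeilRank = 0)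
      (κ * ((p : ℝ) - 2) / (2 * ((p : ℝ) - 1))) := by
  obtain ⟨n, F, hlarge, hdisj, htwist, hflip, hdens⟩ := hF
  refine heightDensityGE_rankZero_of_card_selmer_of_family p
    ⟨UnionMem F, fun AB h ↦ htwist AB h, fun AB h ↦ hflip AB h, hdens, fun ε hε ↦ ?_⟩ hDD
  exact eventually_sum_le_of_heightAverageOn_le (fun i ↦ (F i).Mem) hdisj (UnionMem F)
    (fun _ ↦ Iff.rfl) (fun AB ↦ (Nat.card ((shortWeierstrass AB).selmerGroup p) : ℝ))
    (fun i ↦ h13 (F i) (hlarge i) ε hε)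

end ReductionPrime

end Literature.NumberTheory.EllipticCurves

end
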